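import Summits.AtomisticToContinuum.BoseEinsteinCondensation.Theses.BECBathMassLiouville
import Summits.AtomisticToContinuum.BoseEinsteinCondensation.Theorems.BECBathMassLiouvilleFrozenBathNoBECReduction
import Summits.AtomisticToContinuum.BoseEinsteinCondensation.Theorems.BECBathMassLiouvilleFrozenBathNoBECDeviation
import HarnessLib

/-!
# Route BECBathMassLiouville — `FrozenBathNoBEC` (stmt-AtomisticToContinuum-13803): the proof

The η = ∞ end of the bath-mass dial: a test particle among `M` FROZEN scatterers, placed
independently and uniformly in the torus of side `L = (M/ρ)^{1/3}`, does not condense into the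
constant mode — for all large `M`, outside a set of configurations of probability `≤ ε`, no
near-ground state of `h_Y = -Δ + ∑ⱼ v^per(x - Yⱼ)` (at precision `δ = η(ε, ρ, v)`) has constant-mode
weight `> ε`.

Proof (elementary, as in the item's informal statement; helper files
`BECBathMassLiouvilleFrozenBathNoBEC{Local,Bracketing,Reduction,Void,Probability,Deviation}`):
tile the cell into `k³` sub-cells of side `ℓ ∈ [ℓ₀, 2ℓ₀]`; a sub-cell whose inner cube contains a
scatterer carries potential `W₀ = ∫ min(v, K₀) > 0` (positive scattering length), so by the
Neumann gap a state of quenched energy `≤ 2η` has mass `≤ 8ℓ³η/W₀ ≤ ε/4` on such cells; by Markov,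
with probability `≥ 1 - ε/2` at most `εk³/4` inner cubes are empty; by a second-moment bound, with
probability `≥ 1 - ε/2` some sub-cell of a coarser tiling (side `ℓ' ≥ s + 2R₀`) is empty, which
makes the quenched ground-state energy `≤ s⁻²E₀(1,1) ≤ η`; Cauchy–Schwarz then bounds the
constant-mode weight of every `η`-near-ground state by `ε`.

References: Lieb–Seiringer–Solovej–Yngvason 2005 (objects, Neumann gap); Sznitman 1998
(Lifshitz tails / largest void heuristics).
-/

noncomputable section

namespace Summit.AtomisticToContinuum.BoseEinsteinCondensation.Theorems

open MeasureTheory Metric Set Filter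
open scoped ENNReal NNReal
open Literature.MathematicalPhysics.QuantumManyBody.BoseGas
open Summit.AtomisticToContinuum.BoseEinsteinCondensation.Theorems.FrozenBath

namespace FrozenBath

/-- Volume bookkeeping: `B ⊆ A ∪ D`, `|A| ≤ a`, `|D| ≤ d` give `|B| ≤ a + d`. [folklore] -/
theorem volume_le_of_subset_union {M : ℕ} {B A D : Set (Config M)} {a d : ℝ≥0∞}
    (hA : volume A ≤ a) (hD : volume D ≤ d) (h : B ⊆ A ∪ D) : volume B ≤ a + d :=
  (measure_mono h).trans ((measure_union_le A D).trans (add_le_add hA hD))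

/-- **The Markov deviation is small**: with `ℓ₀ - 2R₀ = 1 + max(0, log(8/ε²))/ρ`, `ℓ ≥ ℓ₀`,
`ℓ - 2R₀ ≤ L` and `L³ = M/ρ` (`M ≥ 1`), `(1 - (ℓ-2R₀)³/L³)^M ≤ e^{-ρ(ℓ-2R₀)³} ≤ ε²/8`. [folklore] -/
theorem deviation_markov {ρ ε R₀ ℓ L : ℝ} (hρ : 0 < ρ) (hε : 0 < ε)
    (hℓ : 2 * R₀ + 1 + max 0 (Real.log (8 / ε ^ 2)) / ρ ≤ ℓ) (hL : ℓ - 2 * R₀ ≤ L) {M : ℕ}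
    (hM : 1 ≤ M) (hL3 : L ^ 3 = M / ρ) :
    (1 - (ℓ - 2 * R₀) ^ 3 / L ^ 3) ^ M ≤ ε ^ 2 / 8 := by
  set m : ℝ := max 0 (Real.log (8 / ε ^ 2)) with hm
  have hm0 : 0 ≤ m := le_max_left _ _
  have ht1 : 1 ≤ ℓ - 2 * R₀ := by
    have : 0 ≤ m / ρ := div_nonneg hm0 hρ.le
    linarith
  have ht0 : 0 ≤ ℓ - 2 * R₀ := by linarith
  have hMpos : (0 : ℝ) < M := by exact_mod_cast hM
  have hL3pos : 0 < L ^ 3 := by rw [hL3]; positivity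
  have hLpos : 0 < L := by
    rcases lt_or_ge 0 L with h | h
    · exact h
    · have : L ^ 3 ≤ 0 := by
        have : L ^ 3 = L * L ^ 2 := by ring
        rw [this]
        exact mul_nonpos_of_nonpos_of_nonneg h (sq_nonneg L)
      linarith
  set x : ℝ := (ℓ - 2 * R₀) ^ 3 / L ^ 3 with hx
  have hx0 : 0 ≤ x := by positivity
  have hx1 : x ≤ 1 := by
    rw [hx, div_le_one hL3pos]
    exact pow_le_pow_left₀ ht0 hL 3
  -- `(1-x)^M ≤ exp(-M x)` and `M x = ρ (ℓ-2R₀)³ ≥ m`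
  have h1 : (1 - x) ^ M ≤ Real.exp (-(M * x)) := by
    calc (1 - x) ^ M ≤ Real.exp (-x) ^ M :=
          pow_le_pow_left₀ (by linarith) (Real.one_sub_le_exp_neg x) M
      _ = Real.exp (-(M * x)) := by rw [← Real.exp_nat_mul]; ring_nf
  have hMx : (M : ℝ) * x = ρ * (ℓ - 2 * R₀) ^ 3 := by
    rw [hx, hL3]
    field_simp
  have hρt : m ≤ ρ * (ℓ - 2 * R₀) ^ 3 := by
    have h3 : ℓ - 2 * R₀ ≤ (ℓ - 2 * R₀) ^ 3 := by
      have : (ℓ - 2 * R₀) ^ 3 = (ℓ - 2 * R₀) * (ℓ - 2 * R₀) ^ 2 := by ring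
      rw [this]
      have : 1 ≤ (ℓ - 2 * R₀) ^ 2 := by nlinarith
      nlinarith
    have h4 : m ≤ ρ * (ℓ - 2 * R₀) := by
      have : 1 + m / ρ ≤ ℓ - 2 * R₀ := by linarith
      have := mul_le_mul_of_nonneg_left this hρ.le
      rw [mul_add, mul_div_cancel₀ _ hρ.ne'] at this
      linarith
    exact h4.trans (mul_le_mul_of_nonneg_left h3 hρ.le)
  have hlog : Real.log (8 / ε ^ 2) ≤ m := le_max_right _ _
  calc (1 - x) ^ M ≤ Real.exp (-(M * x)) := h1
    _ ≤ Real.exp (-Real.log (8 / ε ^ 2)) := by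
        rw [Real.exp_le_exp, hMx]
        linarith
    _ = ε ^ 2 / 8 := by
        rw [Real.exp_neg, Real.exp_log (by positivity), inv_div]

/-- **The second-moment deviation is small**: with `C = (2/ε) e^{16ρℓ₀'³}`, `K ≥ C + 2` cells of
side `ℓ' ≤ 2ℓ₀'` and `M = ρKℓ'³` points, `2/ε ≤ (K-1)((K-1)/K)^M`. [folklore] -/
theorem deviation_void {ρ ε ℓ₀' ℓ' : ℝ} (hρ : 0 < ρ) (hε : 0 < ε) (hℓ'0 : 0 < ℓ')
    (hℓ' : ℓ' ≤ 2 * ℓ₀') {K M : ℕ}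
    (hK : 2 / ε * Real.exp (16 * ρ * ℓ₀' ^ 3) + 2 ≤ K) (hM : (M : ℝ) = ρ * K * ℓ' ^ 3) :
    2 / ε ≤ ((K - 1 : ℕ) : ℝ) * ((((K - 1 : ℕ) : ℝ)) / ((K : ℕ) : ℝ)) ^ M := by
  set C : ℝ := 2 / ε * Real.exp (16 * ρ * ℓ₀' ^ 3) with hC
  have hC0 : 0 ≤ C := by positivity
  have hK2 : (2 : ℝ) ≤ K := by linarith
  have hK1 : 1 ≤ K := by exact_mod_cast (show (1 : ℝ) ≤ K by linarith)
  have hKpos : (0 : ℝ) < K := by linarith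
  have hcast : ((K - 1 : ℕ) : ℝ) = (K : ℝ) - 1 := by rw [Nat.cast_sub hK1, Nat.cast_one]
  have hratio : (((K - 1 : ℕ) : ℝ)) / ((K : ℕ) : ℝ) = 1 - 1 / K := by
    rw [hcast]
    field_simp
  have hpow : Real.exp (-(16 * ρ * ℓ₀' ^ 3)) ≤ ((((K - 1 : ℕ) : ℝ)) / ((K : ℕ) : ℝ)) ^ M := by
    rw [hratio]
    refine le_trans ?_ (exp_neg_le_one_sub_inv_pow hK2 M)
    rw [Real.exp_le_exp, neg_le_neg_iff, hM]
    have h8 : ℓ' ^ 3 ≤ 8 * ℓ₀' ^ 3 := by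
      calc ℓ' ^ 3 ≤ (2 * ℓ₀') ^ 3 := pow_le_pow_left₀ hℓ'0.le hℓ' 3
        _ = 8 * ℓ₀' ^ 3 := by ring
    calc 2 * (ρ * K * ℓ' ^ 3) / K = 2 * ρ * ℓ' ^ 3 := by field_simp
      _ ≤ 2 * ρ * (8 * ℓ₀' ^ 3) := by gcongr
      _ = 16 * ρ * ℓ₀' ^ 3 := by ring
  have hpos : 0 < Real.exp (-(16 * ρ * ℓ₀' ^ 3)) := Real.exp_pos _
  calc 2 / ε = C * Real.exp (-(16 * ρ * ℓ₀' ^ 3)) := by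
        rw [hC, mul_assoc, ← Real.exp_add, add_neg_cancel, Real.exp_zero, mul_one]
    _ ≤ ((K - 1 : ℕ) : ℝ) * Real.exp (-(16 * ρ * ℓ₀' ^ 3)) := by
        apply mul_le_mul_of_nonneg_right _ hpos.le
        rw [hcast]; linarith
    _ ≤ ((K - 1 : ℕ) : ℝ) * ((((K - 1 : ℕ) : ℝ)) / ((K : ℕ) : ℝ)) ^ M := by
        apply mul_le_mul_of_nonneg_left hpow
        rw [hcast]; linarith

/-- Tiling bookkeeping: for `L ≥ 2ℓ₀ > 0` and `k = ⌊L/ℓ₀⌋`, `k ≥ 1` and the actual sub-cell side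
`ℓ = L/k` lies in `[ℓ₀, 2ℓ₀]`. [folklore] -/
theorem floor_tiling {L ℓ₀ : ℝ} (hℓ₀ : 0 < ℓ₀) (hL : 2 * ℓ₀ ≤ L) :
    1 ≤ ⌊L / ℓ₀⌋₊ ∧ ((⌊L / ℓ₀⌋₊ : ℕ) : ℝ) * (L / ⌊L / ℓ₀⌋₊) = L ∧ ℓ₀ ≤ L / ⌊L / ℓ₀⌋₊ ∧
      L / ⌊L / ℓ₀⌋₊ ≤ 2 * ℓ₀ := by
  set k : ℕ := ⌊L / ℓ₀⌋₊ with hk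
  have hLpos : 0 < L := by linarith
  have hq : 2 ≤ L / ℓ₀ := by rw [le_div_iff₀ hℓ₀]; linarith
  have hk1 : 1 ≤ k := Nat.one_le_iff_ne_zero.2 (by
    rw [hk]; exact (Nat.floor_pos.2 (by linarith)).ne')
  have hkpos : (0 : ℝ) < k := by exact_mod_cast hk1
  have hkle : (k : ℝ) ≤ L / ℓ₀ := Nat.floor_le (by positivity)
  have hklt : L / ℓ₀ < k + 1 := Nat.lt_floor_add_one _
  refine ⟨hk1, by field_simp, ?_, ?_⟩
  · rw [le_div_iff₀ hkpos]
    calc ℓ₀ * k ≤ ℓ₀ * (L / ℓ₀) := by gcongr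
      _ = L := by field_simp
  · rw [div_le_iff₀ hkpos]
    have : L / ℓ₀ ≤ 2 * k := by linarith
    calc L = L / ℓ₀ * ℓ₀ := by field_simp
      _ ≤ 2 * k * ℓ₀ := by gcongr
      _ = 2 * ℓ₀ * k := by ring

/-- The truncation level `K₀ = π²/(6ℓ₀²)` is admissible for every actual sub-cell side `ℓ ≤ 2ℓ₀`:
`K₀ ≤ 2π²/(3ℓ²)`. [folklore] -/
theorem truncation_le_gap {ℓ₀ ℓ : ℝ} (hℓ₀ : 0 < ℓ₀) (hℓ : 0 < ℓ) (hℓhi : ℓ ≤ 2 * ℓ₀) :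
    ENNReal.ofReal (Real.pi ^ 2 / (6 * ℓ₀ ^ 2)) ≤ ENNReal.ofReal (2 * Real.pi ^ 2 / (3 * ℓ ^ 2)) := by
  refine ENNReal.ofReal_le_ofReal ?_
  rw [div_le_div_iff₀ (by positivity) (by positivity)]
  have h1 : ℓ ^ 2 ≤ 4 * ℓ₀ ^ 2 := by nlinarith
  have hπ : 0 < Real.pi ^ 2 := by positivity
  nlinarith

/-- The precision `η = εW₀/(256ℓ₀³)` satisfies `32ℓ³η ≤ W₀ε` for `ℓ ≤ 2ℓ₀`. [folklore] -/
theorem precision_le {ℓ₀ ℓ ε : ℝ} (hℓ₀ : 0 < ℓ₀) (hℓ : 0 < ℓ) (hℓhi : ℓ ≤ 2 * ℓ₀) (hε : 0 ≤ ε)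
    {W₀ : ℝ≥0∞} (hWt : W₀ ≠ ⊤) :
    ENNReal.ofReal (32 * ℓ ^ 3 * (ε * W₀.toReal / (256 * ℓ₀ ^ 3))) ≤ W₀ * ENNReal.ofReal ε := by
  have h8 : ℓ ^ 3 ≤ 8 * ℓ₀ ^ 3 := by
    calc ℓ ^ 3 ≤ (2 * ℓ₀) ^ 3 := pow_le_pow_left₀ hℓ.le hℓhi 3
      _ = 8 * ℓ₀ ^ 3 := by ring
  have hW : 0 ≤ W₀.toReal := ENNReal.toReal_nonneg
  have h1 : 32 * ℓ ^ 3 * (ε * W₀.toReal / (256 * ℓ₀ ^ 3)) ≤ ε * W₀.toReal := by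
    rw [mul_div_assoc']
    rw [div_le_iff₀ (by positivity)]
    have : 0 ≤ ε * W₀.toReal := mul_nonneg hε hW
    nlinarith
  calc ENNReal.ofReal (32 * ℓ ^ 3 * (ε * W₀.toReal / (256 * ℓ₀ ^ 3)))
      ≤ ENNReal.ofReal (ε * W₀.toReal) := ENNReal.ofReal_le_ofReal h1
    _ = W₀ * ENNReal.ofReal ε := by
        rw [ENNReal.ofReal_mul hε, ENNReal.ofReal_toReal hWt, mul_comm]

/-- The void scale `s = √(E₁/η) + 1` gives `s⁻²E₁ ≤ η`. [folklore] -/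
theorem void_scale_le {e₁ : ℝ≥0∞} (he₁ : e₁ ≠ ⊤) {η : ℝ} (hη : 0 < η) :
    ENNReal.ofReal ((Real.sqrt (e₁.toReal / η) + 1) ^ 2)⁻¹ * e₁ ≤ ENNReal.ofReal η := by
  set s : ℝ := Real.sqrt (e₁.toReal / η) + 1 with hsdef
  have he0 : 0 ≤ e₁.toReal := ENNReal.toReal_nonneg
  have hs : 0 < s := by rw [hsdef]; positivity
  have hsq : e₁.toReal / η ≤ s ^ 2 := by
    have h1 : Real.sqrt (e₁.toReal / η) ^ 2 = e₁.toReal / η := Real.sq_sqrt (by positivity)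
    have h2 : Real.sqrt (e₁.toReal / η) ≤ s := by rw [hsdef]; linarith
    calc e₁.toReal / η = Real.sqrt (e₁.toReal / η) ^ 2 := h1.symm
      _ ≤ s ^ 2 := pow_le_pow_left₀ (Real.sqrt_nonneg _) h2 2
  rw [← ENNReal.ofReal_toReal he₁, ← ENNReal.ofReal_mul (by positivity)]
  refine ENNReal.ofReal_le_ofReal ?_
  rw [div_le_iff₀ hη] at hsq
  rw [inv_mul_le_iff₀ (by positivity)]
  linarith

/-- `k' ≤ k'³` for `k' ≥ 1`, with the threshold: `C + 2 ≤ k'` gives `C + 2 ≤ k'³`. [folklore] -/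
theorem threshold_le_cube {C : ℝ} {k' : ℕ} (hk' : 1 ≤ k') (h : C + 2 ≤ (k' : ℝ)) :
    C + 2 ≤ ((k' ^ 3 : ℕ) : ℝ) := by
  have hk'1 : (1 : ℝ) ≤ k' := by exact_mod_cast hk'
  calc C + 2 ≤ (k' : ℝ) := h
    _ ≤ (k' : ℝ) ^ 3 := le_self_pow₀ hk'1 (by norm_num)
    _ = ((k' ^ 3 : ℕ) : ℝ) := by push_cast; ring

/-- **The bad configurations lie in the two exceptional sets** (fixed `M`): if the sub-cell tiling
(`L = kℓ`, inner cubes of side `ℓ - 2R₀`) and the coarse tiling (`L = k'ℓ'`, `ℓ' ≥ s + 2R₀`) are in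
place, `K ≤ 2π²/(3ℓ²)`, `0 < W₀(K) < ∞`, `32ℓ³η ≤ W₀(K)ε` and `s⁻²E₀(1,1) ≤ η`, then a configuration
`Y ∈ cell^M` that is bad (near-ground states with constant-mode weight `> ε` at every precision) has
either `≥ εk³/4` empty inner cubes or no empty coarse sub-cell (`not_bad_of_good`,
`iInf_quenched_le_of_emptyCell`). [folklore] -/
theorem bad_subset_union {v : ℝ → ℝ≥0∞} (hvm : Measurable v) {R₀ : ℝ} (hR₀ : 0 ≤ R₀)
    (hv0 : ∀ r, R₀ < r → v r = 0) {k : ℕ} {ℓ L : ℝ} (hℓ : 0 < ℓ) (hk : 1 ≤ k)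
    (hkℓ : (k : ℝ) * ℓ = L) {K : ℝ≥0∞} (hK : K ≤ ENNReal.ofReal (2 * Real.pi ^ 2 / (3 * ℓ ^ 2)))
    (hW0 : ∫⁻ z : Space, min (v ‖z‖) K ≠ 0) (hWt : ∫⁻ z : Space, min (v ‖z‖) K ≠ ⊤)
    {ε η : ℝ} (hε : 0 < ε) (hη : 0 < η)
    (hηε : ENNReal.ofReal (32 * ℓ ^ 3 * η) ≤ (∫⁻ z : Space, min (v ‖z‖) K) * ENNReal.ofReal ε)
    {k' : ℕ} {ℓ' s : ℝ} (hℓ' : 0 < ℓ') (hkℓ' : (k' : ℝ) * ℓ' = L) (hs : 0 < s)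
    (hsℓ : s + 2 * R₀ ≤ ℓ') (hse : ENNReal.ofReal (s ^ 2)⁻¹ * groundStateEnergy 0 1 1 ≤ ENNReal.ofReal η)
    {M : ℕ} [∀ Y : Config M, DecidablePred fun q : SubIdx k => ∀ j, Y j ∉
      cellShift (ℓ - 2 * R₀) (subOffset ℓ q + (WithLp.toLp 2 fun _ : Fin 3 => R₀ : Space))] :
    {Y : Config M | Y ∈ cellN M L ∧ ∀ δ : ℝ≥0∞, 0 < δ → ∃ φ : PeriodicTrialState 1 L,
        (∫⁻ X in cellN 1 L, kineticDensity φ.ψ X +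
            (∑ j : Fin M, periodizedPotential v L (X 0 - Y j)) * (‖φ.ψ X‖₊ : ℝ≥0∞) ^ 2) ≤
          (⨅ θ : PeriodicTrialState 1 L, ∫⁻ X in cellN 1 L, kineticDensity θ.ψ X +
            (∑ j : Fin M, periodizedPotential v L (X 0 - Y j)) * (‖θ.ψ X‖₊ : ℝ≥0∞) ^ 2) + δ ∧
          ENNReal.ofReal ε < condensateOccupation 1 L φ.ψ} ⊆
      {Y : Config M | Y ∈ cellN M L ∧ ENNReal.ofReal (ε * (k : ℝ) ^ 3 / 4) ≤
        ((Finset.univ.filter fun q : SubIdx k => ∀ j, Y j ∉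
          cellShift (ℓ - 2 * R₀) (subOffset ℓ q + (WithLp.toLp 2 fun _ : Fin 3 => R₀ : Space))).card :
            ℝ≥0∞)} ∪
      {Y : Config M | Y ∈ cellN M L ∧ ∀ q : SubIdx k', ∃ j, Y j ∈ subCell ℓ' q} := by
  classical
  rintro Y ⟨hYcell, hbad⟩
  rw [mem_union]
  by_contra hnot
  push Not at hnot
  obtain ⟨hnA, hnD⟩ := hnot
  simp only [mem_setOf_eq, not_and, not_le, not_forall, not_exists] at hnA hnD
  have hcount := hnA hYcell
  obtain ⟨q', hq'⟩ := hnD hYcell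
  -- the void gives a small ground-state energy
  have hE₀ := (iInf_quenched_le_of_emptyCell (v := v) hv0 hR₀ hℓ' hkℓ' hs hsℓ hYcell hq').trans
    hse
  -- the occupied sub-cells
  set S : SubIdx k → Set Space := fun q =>
    cellShift (ℓ - 2 * R₀) (subOffset ℓ q + (WithLp.toLp 2 fun _ : Fin 3 => R₀ : Space)) with hS
  set O : Finset (SubIdx k) := Finset.univ.filter fun q => ∃ j, Y j ∈ S q with hO
  have hocc : ∀ q ∈ O, ∃ j, closedBall (Y j) R₀ ⊆ subCell ℓ q := by
    intro q hq
    rw [hO, Finset.mem_filter] at hq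
    obtain ⟨j, hj⟩ := hq.2
    exact ⟨j, closedBall_subset_subCell_of_mem_inner hj⟩
  have hU : (((Finset.univ \ O).card : ℕ) : ℝ) ≤ ε * (k : ℝ) ^ 3 / 4 := by
    have hset : Finset.univ \ O = Finset.univ.filter fun q => ∀ j, Y j ∉ S q := by
      ext q
      simp [hO]
    rw [hset]
    have hlt := hcount
    rw [← ENNReal.ofReal_natCast, ENNReal.ofReal_lt_ofReal_iff_of_nonneg (Nat.cast_nonneg _)]
      at hlt
    exact hlt.le
  exact not_bad_of_good hℓ hk hkℓ hvm hv0 Y O hocc hK hW0 hWt hε.le hη hU hηε hE₀ hbad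

end FrozenBath

/-- **`FrozenBathNoBEC` (stmt-AtomisticToContinuum-13803), settled positively.** For every
repulsive finite-range `v` with positive scattering length, every `ρ > 0` and `ε > 0`, for all large
`M` (torus of side `L = (M/ρ)^{1/3}`) the set of scatterer configurations `Y ∈ cell^M` for which
the one-body quenched problem `h_Y = -Δ + ∑ⱼ v^per(x - Yⱼ)` has, at every precision `δ`, a
`δ`-near-ground state with constant-mode weight `> ε`, has volume `≤ ε |cell^M|`: the frozen bath
never condenses a test particle. Proof by Neumann bracketing + Markov + a second-moment void
bound, as in the item's informal statement (helper files of the `FrozenBath` namespace).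
[cite: LSSY2005, §1.2 (objects); after (2.50) (Neumann gap)] -/
theorem frozenBathNoBEC_proof :
    Summit.AtomisticToContinuum.BoseEinsteinCondensation.Theses.BECBathMassLiouville.FrozenBathNoBEC := by
  unfold Summit.AtomisticToContinuum.BoseEinsteinCondensation.Theses.BECBathMassLiouville.FrozenBathNoBEC
  intro v hv ha ρ hρ ε hε
  classical
  obtain ⟨hvm, R₁, hR₁⟩ := hv
  -- the range, made nonnegative
  obtain ⟨R₀, hR₀, hv0⟩ : ∃ R₀ : ℝ, 0 ≤ R₀ ∧ ∀ r, R₀ < r → v r = 0 :=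
    ⟨max R₁ 0, le_max_right _ _, fun r hr => hR₁ r (lt_of_le_of_lt (le_max_left _ _) hr)⟩
  -- the sub-cell scale `ℓ₀` and the potential floor `W₀`
  obtain ⟨ℓ₀, hℓ₀def⟩ : ∃ ℓ₀ : ℝ, ℓ₀ = 2 * R₀ + 1 + max 0 (Real.log (8 / ε ^ 2)) / ρ := ⟨_, rfl⟩
  have hm0 : 0 ≤ max 0 (Real.log (8 / ε ^ 2)) / ρ := div_nonneg (le_max_left _ _) hρ.le
  have hℓ₀ : 0 < ℓ₀ := by rw [hℓ₀def]; linarith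
  have h2R₀ : 2 * R₀ + 1 ≤ ℓ₀ := by rw [hℓ₀def]; linarith
  have hK₀pos : 0 < ENNReal.ofReal (Real.pi ^ 2 / (6 * ℓ₀ ^ 2)) := ENNReal.ofReal_pos.2 (by positivity)
  have hW0 : ∫⁻ z : Space, min (v ‖z‖) (ENNReal.ofReal (Real.pi ^ 2 / (6 * ℓ₀ ^ 2))) ≠ 0 :=
    (lintegral_min_pos hvm ha hK₀pos).ne'
  have hWt : ∫⁻ z : Space, min (v ‖z‖) (ENNReal.ofReal (Real.pi ^ 2 / (6 * ℓ₀ ^ 2))) ≠ ⊤ :=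
    (lintegral_min_lt_top hv0 ENNReal.ofReal_ne_top).ne
  set W₀ : ℝ≥0∞ := ∫⁻ z : Space, min (v ‖z‖) (ENNReal.ofReal (Real.pi ^ 2 / (6 * ℓ₀ ^ 2))) with hW₀def
  have hw₀ : 0 < W₀.toReal := ENNReal.toReal_pos hW0 hWt
  -- the precision `η` and the void scale `s`, `ℓ₀'`
  obtain ⟨η, hηdef⟩ : ∃ η : ℝ, η = ε * W₀.toReal / (256 * ℓ₀ ^ 3) := ⟨_, rfl⟩
  have hη : 0 < η := by rw [hηdef]; positivity
  have he₁ : groundStateEnergy 0 1 1 ≠ ⊤ := (groundStateEnergy_one_lt_top 0 one_pos).ne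
  obtain ⟨s, hsdef⟩ : ∃ s : ℝ, s = Real.sqrt ((groundStateEnergy 0 1 1).toReal / η) + 1 := ⟨_, rfl⟩
  have hs : 0 < s := by rw [hsdef]; positivity
  have hse : ENNReal.ofReal (s ^ 2)⁻¹ * groundStateEnergy 0 1 1 ≤ ENNReal.ofReal η := by
    rw [hsdef]; exact void_scale_le he₁ hη
  obtain ⟨ℓ₀', hℓ₀'def⟩ : ∃ ℓ₀' : ℝ, ℓ₀' = s + 2 * R₀ := ⟨_, rfl⟩
  have hℓ₀' : 0 < ℓ₀' := by rw [hℓ₀'def]; linarith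
  obtain ⟨C, hCdef⟩ : ∃ C : ℝ, C = 2 / ε * Real.exp (16 * ρ * ℓ₀' ^ 3) := ⟨_, rfl⟩
  -- eventually: `L` large
  have hev : ∀ᶠ M : ℕ in atTop, max (2 * ℓ₀) (max (2 * ℓ₀') (ℓ₀' * (C + 3))) ≤ sideLength ρ M :=
    (tendsto_sideLength_atTop hρ).eventually (eventually_ge_atTop _)
  filter_upwards [hev, eventually_ge_atTop 1] with M hML hM1
  set L : ℝ := sideLength ρ M with hLdef
  have hL1 : 2 * ℓ₀ ≤ L := le_trans (le_max_left _ _) hML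
  have hL2 : 2 * ℓ₀' ≤ L := le_trans ((le_max_left _ _).trans (le_max_right _ _)) hML
  have hL3' : ℓ₀' * (C + 3) ≤ L := le_trans ((le_max_right _ _).trans (le_max_right _ _)) hML
  have hL3 : L ^ 3 = M / ρ := sideLength_pow_three hρ M
  -- the two tilings
  obtain ⟨hk, hkℓ, hℓlo, hℓhi⟩ := floor_tiling hℓ₀ hL1
  obtain ⟨hk', hkℓ', hℓ'lo, hℓ'hi⟩ := floor_tiling hℓ₀' hL2
  set k : ℕ := ⌊L / ℓ₀⌋₊ with hkdef
  set k' : ℕ := ⌊L / ℓ₀'⌋₊ with hk'def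
  set ℓ : ℝ := L / k with hℓdef
  set ℓ' : ℝ := L / k' with hℓ'def
  have hℓ : 0 < ℓ := lt_of_lt_of_le hℓ₀ hℓlo
  have hℓ' : 0 < ℓ' := lt_of_lt_of_le hℓ₀' hℓ'lo
  have h2R : 2 * R₀ < ℓ := by linarith
  have hℓL : ℓ - 2 * R₀ ≤ L := by
    have h1 : ℓ ≤ L := by
      rw [← hkℓ]
      have : (1 : ℝ) ≤ k := by exact_mod_cast hk
      nlinarith
    linarith
  -- (i) many empty inner cubes: probability ≤ ε/2
  have hℓlo' : 2 * R₀ + 1 + max 0 (Real.log (8 / ε ^ 2)) / ρ ≤ ℓ := by rw [← hℓ₀def]; exact hℓlo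
  have hdev : (1 - (ℓ - 2 * R₀) ^ 3 / L ^ 3) ^ M ≤ ε ^ 2 / 8 :=
    deviation_markov hρ hε hℓlo' hℓL hM1 hL3
  have hA := volume_manyEmpty_le (M := M) hℓ hk hkℓ hR₀ h2R hε hdev
  -- (ii) no empty coarse sub-cell: probability ≤ ε/2
  have hk'R : C + 2 ≤ (k' : ℝ) := by
    have hlt : L / ℓ₀' < (k' : ℝ) + 1 := Nat.lt_floor_add_one _
    have h3 : C + 3 ≤ L / ℓ₀' := by rw [le_div_iff₀ hℓ₀']; linarith
    linarith
  have hKC : 2 / ε * Real.exp (16 * ρ * ℓ₀' ^ 3) + 2 ≤ ((k' ^ 3 : ℕ) : ℝ) := by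
    rw [← hCdef]; exact threshold_le_cube hk' hk'R
  have hMK : (M : ℝ) = ρ * ((k' ^ 3 : ℕ) : ℝ) * ℓ' ^ 3 := by
    have h1 : (M : ℝ) = ρ * L ^ 3 := by rw [hL3]; field_simp
    rw [h1, ← hkℓ']
    push_cast
    ring
  have hdev' := deviation_void hρ hε hℓ' hℓ'hi hKC hMK
  have hD := volume_noVoid_le (M := M) hℓ' hk' hkℓ' hε hdev'
  -- (iii) the bad set lies in the union of the two exceptional sets
  have hK := truncation_le_gap hℓ₀ hℓ hℓhi
  have hηε : ENNReal.ofReal (32 * ℓ ^ 3 * η) ≤ W₀ * ENNReal.ofReal ε := by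
    rw [hηdef]; exact precision_le hℓ₀ hℓ hℓhi hε.le hWt
  have hsℓ : s + 2 * R₀ ≤ ℓ' := by rw [← hℓ₀'def]; exact hℓ'lo
  refine (volume_le_of_subset_union hA hD (bad_subset_union hvm hR₀ hv0 hℓ hk hkℓ hK hW0 hWt
    hε hη hηε hℓ' hkℓ' hs hsℓ hse)).trans (le_of_eq ?_)
  rw [← add_mul, ← ENNReal.ofReal_add (by positivity) (by positivity), add_halves]

end Summit.AtomisticToContinuum.BoseEinsteinCondensation.Theorems

end
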